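import Summits.BirchSwinnertonDyer.BirchSwinnertonDyer.Theorems.ByReductionTypeAtTwoAdditivePotMultConjATwoAdmissibleCarriers
import Summits.BirchSwinnertonDyer.BirchSwinnertonDyer.Theorems.ByReductionTypeAtTwoAdditivePotMultConjATwoCubicFieldDoor
import HarnessLib

/-!
# C4″ `AdditivePotMultOverKAtTwo` (item stmt-BirchSwinnertonDyer-22618), the (A)₂ input (I1M′): two more admissible carriers on the `Δ < 0`
# half — `ℚ(x(T), √Δ)` (= `ℚ(E[2])`) and `ℚ(x(T), √(2Δ))` — and the `Δ < 0` half of v11's binder from «`μ₂ = 0` for SOME of the five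
# carriers {`ℚ(x(T))`, `ℚ(x(T),√−1)`, `ℚ(x(T),√−2)`, `ℚ(x(T),√Δ)`, `ℚ(x(T),√(2Δ))`}»

Cell `bsd-2adic`, seat `bsd-2adic-k4-w3` GEN 10 (explicit unit (309)(7); `--supports 22618`; sequel of `…ConjATwoAdmissibleCarriers`).
HONEST FRAMING (D-0036/D-0054): THEOREMS ONLY — no definition, no named fact, no `sorry`; closes nothing; nothing booked; BSD is not proved by
any of this. Every `μ₂ = 0` input is an OPEN Iwasawa statement for an explicit number field; nothing is asserted about it.

WHY. eng-2 GEN 15's ENGINE-2 census reads `μ₂(ℚ(x(T))^cyc) = 0` on 268 of the 269 `Δ < 0` rows; the one row left (162368bg1) is undecided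
through layer 3 of the CUBIC tower (layer 4 = degree 48, cost-obstructed class). The admissibility mechanism of `…ConjATwoAdmissibleCarriers`
(`x` fixed by `ker ρ̄_{E,2} ⊓ ker χ₂`, carrier totally complex) also admits, when `Δ < 0`, `x² = Δ` (`x = ±4δ ∈ ℚ(E[2])`; the carrier is the
sextic `ℚ(E[2])` itself, w2 GEN 7's `TotallyComplexMu` door in the `β`-currency) and `x² = 2Δ` (`x = ±4·√2·δ`, `√2 = ζ₈ + ζ₈⁷ ∈ ℚ(μ₈)`): two
more degree-`6` CM-type carriers per `Δ < 0` row whose first layers (degrees 6/12/24) are cheaper than the cubic tower's layer 4.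

* §1 `smul_eq_self_of_sq_eq_two_of_cyclotomicCharacter_eq_one` (`√2`), `smul_eq_self_of_sq_eq_Δ`, `smul_eq_self_of_sq_eq_two_mul_Δ`.
* §2 doors (every model, `Δ < 0`): **`conjA_two_of_classicalMu_cubicField_adjoin_sqrt_Δ`**, **`conjA_two_of_classicalMu_cubicField_adjoin_sqrt_two_mul_Δ`**.
* §3 **`hAnaMI_negDisc_of_exists_admissibleCarrierMu`** — the `Δ < 0` half of (I1M′) from «at each curve and root `β`, EITHER `μ₂(ℚ⟮β⟯^cyc) = 0`
  (GEN 9's cubic door) OR some `x` with `x² ∈ {−1, −2, Δ(W), 2Δ(W)}` has `μ₂ = 0` along the cyclotomic `ℤ₂`-tower of `ℚ⟮β⟯ ⊔ ℚ⟮x⟯`»;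
  **`hAnaMI_of_exists_admissibleCarrierMu`** — (I1M′) VERBATIM from the two «SOME carrier» halves.

References: [CoatesSujatha2005] Conj. A, Thm. 3.4; [Lim2017FineSelmer] §3 Thm. 3.5, Lemma 3.2; [Iwasawa1973MuInvariants] §1, Thm. 2/3;
[SilvermanAEC2009] III.§1, VIII.§1; [Washington1997] §13.1; [Kato2004Asterisque] Conj. 12.10 (p. 224); tree p718233, p733022, p737622, p737866, p738892.
-/

set_option autoImplicit false
-- the Theorems namespace of this sub repeats the summit name by design (D-0017 nested layout)
set_option linter.dupNamespace false

noncomputable section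

open scoped Classical NumberField Polynomial IntermediateField
open NumberField Field Polynomial IntermediateField

namespace Summit.BirchSwinnertonDyer.BirchSwinnertonDyer.Theorems.AddKatoTwo

open WeierstrassCurve Literature.NumberTheory.EllipticCurves Literature.NumberTheory.EllipticCurves.ZpExtension
  Literature.NumberTheory.GaloisRepresentations Literature.NumberTheory.IwasawaTheory Literature.NumberTheory.NumberFields
  Literature.NumberTheory.EllipticCurves.Rank1Residual
  Literature.NumberTheory.EllipticCurves.DokchitserDokchitser2012

/-! ## §1 Two more admissible elements -/

section Fixed

variable {K : Type} [Field K] [CharZero K] (W : WeierstrassCurve K) [W.IsElliptic]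

omit W in
/-- **`χ₂(σ) = 1 ⟹ σ` fixes `√2`** (`x² = 2`): `x = ±(ζ − ζ³)` for a primitive `8`-th root of unity `ζ` (`ζ⁴ = −1`, `ζ − ζ³ = ζ + ζ⁷`,
`(ζ − ζ³)² = ζ²(1 + ζ⁴) − 2ζ⁴ = 2`), and `σ` fixes `ζ`. [cite: Washington1997, §13.1] -/
theorem smul_eq_self_of_sq_eq_two_of_cyclotomicCharacter_eq_one (x : AlgebraicClosure K) (hx : x ^ 2 = 2)
    {σ : absoluteGaloisGroup K} (h : GaloisRep.cyclotomicCharacter K 2 σ = 1) : σ • x = x := by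
  obtain ⟨ζ, hζ⟩ := IsAlgClosed.exists_pow_nat_eq (-1 : AlgebraicClosure K) (by norm_num : 0 < 4)
  have hζ8 : ζ ^ 2 ^ 3 = 1 := by
    rw [show (2 : ℕ) ^ 3 = 4 * 2 by norm_num, pow_mul, hζ]; norm_num
  have hfix : σ • ζ = ζ := smul_eq_self_of_pow_two_pow_eq_one_of_cyclotomicCharacter_eq_one (by norm_num) ζ hζ8 h
  have hy : (ζ - ζ ^ 3) ^ 2 = 2 := by
    have e : (ζ - ζ ^ 3) ^ 2 = ζ ^ 2 * (1 + ζ ^ 4) - 2 * ζ ^ 4 := by ring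
    rw [e, hζ]; ring
  refine smul_eq_self_of_sq_eq_sq (c := ζ - ζ ^ 3) (by rw [hx, hy]) ?_
  rw [smul_sub, smul_pow', hfix]

/-- **`√Δ = ±4δ ∈ K(E[2])` is admissible**: `x² = Δ` ⟹ `σ • x = x` for every `σ` fixing `E[2]` pointwise.
[cite: SilvermanAEC2009, III.§1 and VIII.§1] -/
theorem smul_eq_self_of_sq_eq_Δ (x : AlgebraicClosure K) (hx : x ^ 2 = algebraMap K (AlgebraicClosure K) W.Δ)
    {σ : absoluteGaloisGroup K} (hσ : ∀ T : W.geomTorsion 2, σ • T = T) : σ • x = x :=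
  smul_eq_self_of_sq_eq_sq (c := 4 * delta W two_ne_zero) (by rw [four_mul_delta_sq W two_ne_zero, hx])
    (smul_four_mul_delta_eq_self W two_ne_zero hσ)

/-- **`√(2Δ) = ±4·√2·δ` is admissible**: `x² = 2Δ` ⟹ `σ • x = x` for every `σ` fixing `E[2]` pointwise with `χ₂(σ) = 1`.
[cite: SilvermanAEC2009, III.§1 and VIII.§1] [cite: Washington1997, §13.1] -/
theorem smul_eq_self_of_sq_eq_two_mul_Δ (x : AlgebraicClosure K) (hx : x ^ 2 = 2 * algebraMap K (AlgebraicClosure K) W.Δ)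
    {σ : absoluteGaloisGroup K} (hσ : ∀ T : W.geomTorsion 2, σ • T = T) (h : GaloisRep.cyclotomicCharacter K 2 σ = 1) :
    σ • x = x := by
  obtain ⟨s, hs⟩ := IsAlgClosed.exists_pow_nat_eq (2 : AlgebraicClosure K) two_pos
  refine smul_eq_self_of_sq_eq_sq (c := s * (4 * delta W two_ne_zero)) ?_ ?_
  · rw [mul_pow, hs, four_mul_delta_sq W two_ne_zero, hx]
  · rw [smul_mul', smul_eq_self_of_sq_eq_two_of_cyclotomicCharacter_eq_one s hs h, smul_four_mul_delta_eq_self W two_ne_zero hσ]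

end Fixed

/-! ## §2 Over `ℚ`, every model, `Δ < 0`: the carriers `ℚ(β, √Δ)` and `ℚ(β, √(2Δ))` -/

section RatDoors

variable (W : WeierstrassCurve ℚ) [W.IsElliptic]

/-- **(A)₂(W) from `μ₂ = 0` of the sextic `ℚ(β, √Δ)`** — every model with `Δ(W) < 0` (`x² = Δ(W)`; the carrier is `ℚ(E[2])` itself:
cf. w2 GEN 7's `TotallyComplexMu.conjA_two_of_classicalMu_divisionField_two_of_Δ_neg` in the `W.divisionField 2` currency).
[cite: CoatesSujatha2005, Conj. A and Thm. 3.4] [cite: Lim2017FineSelmer, §3 Thm. 3.5 and Lemma 3.2] -/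
theorem conjA_two_of_classicalMu_cubicField_adjoin_sqrt_Δ (hΔ : W.Δ < 0) {β : AlgebraicClosure ℚ}
    (hβ : aeval β W.twoTorsionPolynomial.toPoly = 0) {x : AlgebraicClosure ℚ}
    (hx : x ^ 2 = algebraMap ℚ (AlgebraicClosure ℚ) W.Δ)
    (hμ : ∀ κF : ZpExtension ↥(IntermediateField.adjoin ℚ ({β} : Set (AlgebraicClosure ℚ)) ⊔
        IntermediateField.adjoin ℚ ({x} : Set (AlgebraicClosure ℚ))) 2, κF.IsCyclotomic → ClassicalMuVanishes κF)
    (κ : ZpExtension ℚ 2) (hκ : κ.IsCyclotomic) :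
    ∃ (γ : absoluteGaloisGroup ℚ) (D : W.FineSelmerDualData κ γ),
      Module.Finite ℤ_[2] (RestrictScalars ℤ_[2] (IwasawaAlgebra 2) D.X) :=
  conjA_two_of_classicalMu_cubicField_adjoin_of_fixed W hβ (q := W.Δ) hΔ hx
    (fun _ hT _ ↦ smul_eq_self_of_sq_eq_Δ W x hx hT) hμ κ hκ

/-- **(A)₂(W) from `μ₂ = 0` of the sextic `ℚ(β, √(2Δ))`** — every model with `Δ(W) < 0` (`x² = 2Δ(W)`; `√(2Δ) = 4·√2·δ ∈ ℚ(E[2], μ₈)`).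
[cite: CoatesSujatha2005, Conj. A and Thm. 3.4] [cite: Lim2017FineSelmer, §3 Thm. 3.5 and Lemma 3.2] -/
theorem conjA_two_of_classicalMu_cubicField_adjoin_sqrt_two_mul_Δ (hΔ : W.Δ < 0) {β : AlgebraicClosure ℚ}
    (hβ : aeval β W.twoTorsionPolynomial.toPoly = 0) {x : AlgebraicClosure ℚ}
    (hx : x ^ 2 = 2 * algebraMap ℚ (AlgebraicClosure ℚ) W.Δ)
    (hμ : ∀ κF : ZpExtension ↥(IntermediateField.adjoin ℚ ({β} : Set (AlgebraicClosure ℚ)) ⊔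
        IntermediateField.adjoin ℚ ({x} : Set (AlgebraicClosure ℚ))) 2, κF.IsCyclotomic → ClassicalMuVanishes κF)
    (κ : ZpExtension ℚ 2) (hκ : κ.IsCyclotomic) :
    ∃ (γ : absoluteGaloisGroup ℚ) (D : W.FineSelmerDualData κ γ),
      Module.Finite ℤ_[2] (RestrictScalars ℤ_[2] (IwasawaAlgebra 2) D.X) :=
  conjA_two_of_classicalMu_cubicField_adjoin_of_fixed W hβ (q := 2 * W.Δ) (by linarith) (by rw [hx, map_mul]; simp)
    (fun _ hT hχ ↦ smul_eq_self_of_sq_eq_two_mul_Δ W x hx hT hχ) hμ κ hκ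

end RatDoors

/-! ## §3 v11's binder (I1M′): the `Δ < 0` half from SOME of five carriers; (I1M′) VERBATIM from the two «SOME carrier» halves -/

/-- **The `Δ < 0` half of (I1M′) from «SOME of the five carriers `ℚ(x(T))`, `ℚ(x(T),√−1)`, `ℚ(x(T),√−2)`, `ℚ(x(T),√Δ)`, `ℚ(x(T),√(2Δ))` has
`μ₂ = 0`» at each curve and root** (the first alternative is GEN 9's cubic door `conjA_two_of_classicalMu_cubicField_of_Δ_neg_of_isGloballyMinimal`,
whose hypothesis eng-2's E2 census reads on 268/269 rows). OPEN inputs; nothing asserted. [cite: CoatesSujatha2005, Conj. A and Thm. 3.4]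
[cite: Iwasawa1973MuInvariants, Thm. 2 and Thm. 3] [cite: Kato2004Asterisque, Conj. 12.10 (p. 224)] -/
theorem hAnaMI_negDisc_of_exists_admissibleCarrierMu
    (hμx : ∀ (W : WeierstrassCurve ℚ) [W.IsElliptic] [W.IsGloballyMinimal], ¬ W.HasCM → W.analyticRank = 0 →
      Addv W 2 → padicValRat 2 W.j < 0 → W.HasIrreducibleModPGaloisRep 2 → W.Δ < 0 →
      ∀ β : AlgebraicClosure ℚ, aeval β W.twoTorsionPolynomial.toPoly = 0 →
      (∀ κP : ZpExtension ↥(IntermediateField.adjoin ℚ ({β} : Set (AlgebraicClosure ℚ))) 2,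
          κP.IsCyclotomic → ClassicalMuVanishes κP) ∨
      ∃ x : AlgebraicClosure ℚ, (x ^ 2 = -1 ∨ x ^ 2 = -2 ∨ x ^ 2 = algebraMap ℚ (AlgebraicClosure ℚ) W.Δ ∨
          x ^ 2 = 2 * algebraMap ℚ (AlgebraicClosure ℚ) W.Δ) ∧
        ∀ κF : ZpExtension ↥(IntermediateField.adjoin ℚ ({β} : Set (AlgebraicClosure ℚ)) ⊔
            IntermediateField.adjoin ℚ ({x} : Set (AlgebraicClosure ℚ))) 2, κF.IsCyclotomic → ClassicalMuVanishes κF) :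
    ∀ (W : WeierstrassCurve ℚ) [W.IsElliptic] [W.IsGloballyMinimal], ¬ W.HasCM → W.analyticRank = 0 →
      Addv W 2 → padicValRat 2 W.j < 0 → W.HasIrreducibleModPGaloisRep 2 → W.Δ < 0 →
      ∀ β : AlgebraicClosure ℚ, aeval β W.twoTorsionPolynomial.toPoly = 0 →
      ∀ (κ : ZpExtension ℚ 2), κ.IsCyclotomic →
        ∃ (γ : Field.absoluteGaloisGroup ℚ) (D : W.FineSelmerDualData κ γ),
          Module.Finite ℤ_[2] (RestrictScalars ℤ_[2] (IwasawaAlgebra 2) D.X) := by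
  intro W _ _ hcm hr hadd hj hirr hΔ β hβ κ hκ
  rcases hμx W hcm hr hadd hj hirr hΔ β hβ with hμ | ⟨x, hx, hμ⟩
  · exact conjA_two_of_classicalMu_cubicField_of_Δ_neg_of_isGloballyMinimal W hΔ hirr hβ hμ κ hκ
  · rcases hx with hx | hx | hx | hx
    · exact conjA_two_of_classicalMu_cubicField_adjoin_I W hβ hx hμ κ hκ
    · exact conjA_two_of_classicalMu_cubicField_adjoin_sqrt_neg_two W hβ hx hμ κ hκ
    · exact conjA_two_of_classicalMu_cubicField_adjoin_sqrt_Δ W hΔ hβ hx hμ κ hκ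
    · exact conjA_two_of_classicalMu_cubicField_adjoin_sqrt_two_mul_Δ W hΔ hβ hx hμ κ hκ

/-- **v11's binder (I1M′) `hAnaMI` VERBATIM from the two «SOME carrier» halves** — `Δ < 0`: one of the five carriers above; `0 < Δ`: one of
the four CM-sextics `ℚ(x(T), x)`, `x² ∈ {−1, −2, −Δ, −2Δ}` (`hAnaMI_posDisc_of_exists_admissibleCarrierMu`). The weakest per-curve form of the
(A)₂ input this seat can type: per row ANY ONE classical `μ₂`-certificate among up to five towers serves. OPEN inputs; nothing asserted; no
restate of 19098 / 22618 asked (D-0152). [cite: CoatesSujatha2005, Conj. A and Thm. 3.4] [cite: Kato2004Asterisque, Conj. 12.10 (p. 224)] -/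
theorem hAnaMI_of_exists_admissibleCarrierMu
    (hμn : ∀ (W : WeierstrassCurve ℚ) [W.IsElliptic] [W.IsGloballyMinimal], ¬ W.HasCM → W.analyticRank = 0 →
      Addv W 2 → padicValRat 2 W.j < 0 → W.HasIrreducibleModPGaloisRep 2 → W.Δ < 0 →
      ∀ β : AlgebraicClosure ℚ, aeval β W.twoTorsionPolynomial.toPoly = 0 →
      (∀ κP : ZpExtension ↥(IntermediateField.adjoin ℚ ({β} : Set (AlgebraicClosure ℚ))) 2,
          κP.IsCyclotomic → ClassicalMuVanishes κP) ∨
      ∃ x : AlgebraicClosure ℚ, (x ^ 2 = -1 ∨ x ^ 2 = -2 ∨ x ^ 2 = algebraMap ℚ (AlgebraicClosure ℚ) W.Δ ∨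
          x ^ 2 = 2 * algebraMap ℚ (AlgebraicClosure ℚ) W.Δ) ∧
        ∀ κF : ZpExtension ↥(IntermediateField.adjoin ℚ ({β} : Set (AlgebraicClosure ℚ)) ⊔
            IntermediateField.adjoin ℚ ({x} : Set (AlgebraicClosure ℚ))) 2, κF.IsCyclotomic → ClassicalMuVanishes κF)
    (hμp : ∀ (W : WeierstrassCurve ℚ) [W.IsElliptic] [W.IsGloballyMinimal], ¬ W.HasCM → W.analyticRank = 0 →
      Addv W 2 → padicValRat 2 W.j < 0 → W.HasIrreducibleModPGaloisRep 2 → 0 < W.Δ →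
      ∀ β : AlgebraicClosure ℚ, aeval β W.twoTorsionPolynomial.toPoly = 0 →
      ∃ x : AlgebraicClosure ℚ, (x ^ 2 = -1 ∨ x ^ 2 = -2 ∨ x ^ 2 = -algebraMap ℚ (AlgebraicClosure ℚ) W.Δ ∨
          x ^ 2 = -2 * algebraMap ℚ (AlgebraicClosure ℚ) W.Δ) ∧
        ∀ κF : ZpExtension ↥(IntermediateField.adjoin ℚ ({β} : Set (AlgebraicClosure ℚ)) ⊔
            IntermediateField.adjoin ℚ ({x} : Set (AlgebraicClosure ℚ))) 2, κF.IsCyclotomic → ClassicalMuVanishes κF) :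
    ∀ (W : WeierstrassCurve ℚ) [W.IsElliptic] [W.IsGloballyMinimal], ¬ W.HasCM → W.analyticRank = 0 →
      Addv W 2 → padicValRat 2 W.j < 0 → W.HasIrreducibleModPGaloisRep 2 → ¬ IsAbelianGalois ℚ (W.divisionField 2) →
      ∀ (κ : ZpExtension ℚ 2), κ.IsCyclotomic →
        ∃ (γ : Field.absoluteGaloisGroup ℚ) (D : W.FineSelmerDualData κ γ),
          Module.Finite ℤ_[2] (RestrictScalars ℤ_[2] (IwasawaAlgebra 2) D.X) := by
  intro W _ _ hcm hr hadd hj hirr hab κ hκ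
  rcases lt_or_gt_of_ne W.isUnit_Δ.ne_zero with hΔ | hΔ
  · obtain ⟨β, hβ⟩ := exists_aeval_twoTorsionPolynomial_eq_zero W
    exact hAnaMI_negDisc_of_exists_admissibleCarrierMu hμn W hcm hr hadd hj hirr hΔ β hβ κ hκ
  · exact hAnaMI_posDisc_of_exists_admissibleCarrierMu hμp W hcm hr hadd hj hirr hab hΔ κ hκ

end Summit.BirchSwinnertonDyer.BirchSwinnertonDyer.Theorems.AddKatoTwo

end
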